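import Mathlib
import Summits.AtomisticToContinuum.HydrodynamicLimit.Theorems.ImplosionDichotomyDenseExcursionSonicCavityDefs
import Summits.AtomisticToContinuum.HydrodynamicLimit.Theorems.ImplosionDichotomyDenseExcursionPackingResolventFarField

/-!
# Profile facts for the packing-resolvent gain: digested cavity-tube data, far-field window, bounds on `x ≥ 0`
# (crux `DenseExcursion`, stmt-AtomisticToContinuum-12586, line `sonic-cavity-renewal` v8, stub `stub_packingResolventW`)

Helper file (`--supports stmt-AtomisticToContinuum-12586`) for the registered stub `stub_packingResolventW` (skeleton v8;
registered helper here: `packingResolventW_tubeDigest`). The barrier a-priori estimate consumes the profile only through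
finitely many pointwise facts; this file extracts them once from `IsMonatomicProfile` and `CavityTube`:

* `packingResolventW_tubeDigest`: the constants `s₀ ∈ [7/10, 1]` of the centre expansion and the pointwise forms used by
  the inner region (`|W − (r−1)|, |eˣS − s₀| ≤ e^{2x}/10 + 2e^{4x}`, `|W′|, |eˣ(S + S′)| ≤ e^{2x}/5 + 2e^{4x}` on `x ≤ 0`),
  by the outer zone A (`|W| ≤ 1/4`, `|W′| ≤ 1/2`, `7/10 ≤ eˣS ≤ 1` on `x ≤ 1`; `|S + S′| ≤ 11/5` on `x ≤ 0`), the sonic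
  signs (`W + S > 1` on `x < 0`, `< 1` on `x > 0`, `= 1` at `0`) and the monotonicity of `S` on `x ≤ 1`;
* `profile_bounds_Ici`: ONE bound `B₀ ≥ 1` for `|W|, |W′|, S, |S′|` on `x ≥ 0` (continuity + far-field limits);
* `profile_farField_window`: a point `X_F ≥ 1` beyond which the profile is `1/2`-close to its far-field limit in the six
  quantities consumed by `packingResolventW_farFieldQ`.

Qualitative where allowed (the constants `C, k₀` of `PackingResolventW` are existential): no datum beyond the tube.
-/

noncomputable section

open Set Filter Topology
open scoped ContDiff

namespace Summit.AtomisticToContinuum.HydrodynamicLimit.Theorems.PackingAnalyticImplosion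

open Summit.AtomisticToContinuum.HydrodynamicLimit.Theorems.R2OneModeTwoConditions
open Summit.AtomisticToContinuum.HydrodynamicLimit.Theorems.SonicCavityRenewal

/-- A continuous real function with a finite limit at `+∞` is bounded on `[0, ∞)`. [folklore] -/
theorem exists_bound_Ici_of_tendsto {g : ℝ → ℝ} {l : ℝ} (hg : Continuous g) (hl : Tendsto g atTop (𝓝 l)) :
    ∃ B : ℝ, ∀ x, 0 ≤ x → |g x| ≤ B := by
  have ev : ∀ᶠ x in atTop, |g x - l| < 1 := by
    have h1 := (hl.sub_const l).abs
    rw [sub_self, abs_zero] at h1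
    exact h1.eventually (gt_mem_nhds (by norm_num : (0:ℝ) < 1))
  obtain ⟨X, hX⟩ := (ev.and (eventually_ge_atTop 0)).exists_forall_of_atTop
  obtain ⟨M, hM⟩ := (isCompact_Icc : IsCompact (Icc 0 X)).exists_bound_of_continuousOn hg.continuousOn
  refine ⟨max M (|l| + 1), fun x hx => ?_⟩
  rcases le_or_gt x X with h | h
  · have := hM x ⟨hx, h⟩
    rw [Real.norm_eq_abs] at this
    exact this.trans (le_max_left _ _)
  · have h1 := (hX x h.le).1
    have h2 : |g x| ≤ |l| + 1 := by
      calc |g x| = |(g x - l) + l| := by ring_nf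
        _ ≤ |g x - l| + |l| := abs_add_le _ _
        _ ≤ |l| + 1 := by linarith
    exact h2.trans (le_max_right _ _)

/-- **ONE BOUND ON `x ≥ 0`**: for a monatomic profile there is `B₀ ≥ 1` with `|W|, |W′|, S, |S′| ≤ B₀` on `x ≥ 0`
(`W, W′, S → 0` and `S′ = (S′/S)·S → (−r)·0`; continuity on compacts). [folklore] -/
theorem profile_bounds_Ici {r : ℝ} {W S : ℝ → ℝ} (hP : IsMonatomicProfile r W S) :
    ∃ B₀ : ℝ, 1 ≤ B₀ ∧ ∀ x, 0 ≤ x → |W x| ≤ B₀ ∧ |deriv W x| ≤ B₀ ∧ S x ≤ B₀ ∧ |deriv S x| ≤ B₀ := by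
  obtain ⟨tW, tS, tW', tσ, -⟩ := profile_farField_limits hP
  obtain ⟨-, -, hWs, hSs, hSpos, -⟩ := hP
  have hWc : Continuous W := hWs.continuous
  have hSc : Continuous S := hSs.continuous
  have hW'c : Continuous (deriv W) := hWs.continuous_deriv (by simp)
  have hS'c : Continuous (deriv S) := hSs.continuous_deriv (by simp)
  have tS' : Tendsto (deriv S) atTop (𝓝 0) := by
    have h := tσ.mul tS
    rw [mul_zero] at h
    exact h.congr fun x => div_mul_cancel₀ _ (hSpos x).ne'
  obtain ⟨B₁, hB₁⟩ := exists_bound_Ici_of_tendsto hWc tW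
  obtain ⟨B₂, hB₂⟩ := exists_bound_Ici_of_tendsto hW'c tW'
  obtain ⟨B₃, hB₃⟩ := exists_bound_Ici_of_tendsto hSc tS
  obtain ⟨B₄, hB₄⟩ := exists_bound_Ici_of_tendsto hS'c tS'
  refine ⟨max 1 (max B₁ (max B₂ (max B₃ B₄))), le_max_left _ _, fun x hx => ⟨?_, ?_, ?_, ?_⟩⟩
  · exact (hB₁ x hx).trans (le_trans (le_max_left _ _) (le_max_right _ _))
  · exact (hB₂ x hx).trans (le_trans (le_trans (le_max_left _ _) (le_max_right _ _)) (le_max_right _ _))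
  · exact ((le_abs_self _).trans (hB₃ x hx)).trans
      (le_trans (le_trans (le_trans (le_max_left _ _) (le_max_right _ _)) (le_max_right _ _)) (le_max_right _ _))
  · exact (hB₄ x hx).trans
      (le_trans (le_trans (le_trans (le_max_right _ _) (le_max_right _ _)) (le_max_right _ _)) (le_max_right _ _))

/-- **THE FAR-FIELD WINDOW**: for a monatomic profile there is `X_F ≥ 1` beyond which `S ≤ 1/2`, `|W| ≤ 1/2`, `|W′| ≤ 1`,
`|S′/S + r| ≤ 1`, `(W − 1)² − S² ≥ 1/2` and `(W − 1)/((W − 1)² − S²) ≤ −1/2` (limits `0, 0, 0, −r, 1, −1`). [folklore] -/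
theorem profile_farField_window {r : ℝ} {W S : ℝ → ℝ} (hP : IsMonatomicProfile r W S) :
    ∃ X : ℝ, 1 ≤ X ∧ ∀ x, X ≤ x → S x ≤ 1 / 2 ∧ |W x| ≤ 1 / 2 ∧ |deriv W x| ≤ 1 ∧ |deriv S x / S x + r| ≤ 1 ∧
      1 / 2 ≤ (W x - 1) ^ 2 - S x ^ 2 ∧ (W x - 1) / ((W x - 1) ^ 2 - S x ^ 2) ≤ -(1 / 2) := by
  obtain ⟨tW, tS, tW', tσ, tD⟩ := profile_farField_limits hP
  have ev1 : ∀ᶠ x in atTop, S x ≤ 1 / 2 := tS.eventually (ge_mem_nhds (by norm_num : (0:ℝ) < 1 / 2))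
  have ev2 : ∀ᶠ x in atTop, |W x| ≤ 1 / 2 := by
    have := tW.abs
    rw [abs_zero] at this
    exact this.eventually (ge_mem_nhds (by norm_num : (0:ℝ) < 1 / 2))
  have ev3 : ∀ᶠ x in atTop, |deriv W x| ≤ 1 := by
    have := tW'.abs
    rw [abs_zero] at this
    exact this.eventually (ge_mem_nhds (by norm_num : (0:ℝ) < 1))
  have ev4 : ∀ᶠ x in atTop, |deriv S x / S x + r| ≤ 1 := by
    have h := (tσ.add_const r).abs
    rw [neg_add_cancel, abs_zero] at h
    exact h.eventually (ge_mem_nhds (by norm_num : (0:ℝ) < 1))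
  have ev5 : ∀ᶠ x in atTop, 1 / 2 ≤ (W x - 1) ^ 2 - S x ^ 2 := tD.eventually (le_mem_nhds (by norm_num : (1 / 2 : ℝ) < 1))
  have ev6 : ∀ᶠ x in atTop, (W x - 1) / ((W x - 1) ^ 2 - S x ^ 2) ≤ -(1 / 2) := by
    have h := (tW.sub_const 1).div tD one_ne_zero
    have e : ((0:ℝ) - 1) / 1 = -1 := by norm_num
    rw [e] at h
    exact h.eventually (ge_mem_nhds (by norm_num : (-1 : ℝ) < -(1 / 2)))
  obtain ⟨X, hX⟩ := (ev1.and (ev2.and (ev3.and (ev4.and (ev5.and (ev6.and (eventually_ge_atTop 1))))))).exists_forall_of_atTop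
  refine ⟨max X 1, le_max_right _ _, fun x hx => ?_⟩
  obtain ⟨h1, h2, h3, h4, h5, h6, -⟩ := hX x (le_trans (le_max_left _ _) hx)
  exact ⟨h1, h2, h3, h4, h5, h6⟩

/-- **Registered helper `packingResolventW_tubeDigest` of `stub_packingResolventW`: THE DIGESTED CAVITY TUBE.** From
`IsMonatomicProfile` and `CavityTube`: a centre constant `s₀ ∈ [7/10, 1]` with the pointwise centre expansion
(`x ≤ 0`: `|W − (r−1)|, |eˣS − s₀| ≤ e^{2x}/10 + 2e^{4x}`, `|W′|, |eˣ(S + S′)| ≤ e^{2x}/5 + 2e^{4x}`, `|S + S′| ≤ 11/5`), the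
envelope (`x ≤ 1`: `|W| ≤ 1/4`, `|W′| ≤ 1/2`, `7/10 ≤ eˣS ≤ 1`), the sonic signs and the monotonicity of `S` on `x ≤ 1`.
[folklore] -/
theorem packingResolventW_tubeDigest : ∀ (r : ℝ) (W S : ℝ → ℝ), IsMonatomicProfile r W S → CavityTube r W S → ∃ s₀ : ℝ, 7 / 10 ≤ s₀ ∧ s₀ ≤ 1 ∧ (∀ x, x ≤ 0 → |W x - (r - 1)| ≤ Real.exp x ^ 2 / 10 + 2 * Real.exp x ^ 4 ∧ |deriv W x| ≤ Real.exp x ^ 2 / 5 + 2 * Real.exp x ^ 4 ∧ |Real.exp x * S x - s₀| ≤ Real.exp x ^ 2 / 10 + 2 * Real.exp x ^ 4 ∧ |Real.exp x * (S x + deriv S x)| ≤ Real.exp x ^ 2 / 5 + 2 * Real.exp x ^ 4 ∧ |S x + deriv S x| ≤ 11 / 5) ∧ (∀ x, x ≤ 1 → |W x| ≤ 1 / 4 ∧ |deriv W x| ≤ 1 / 2 ∧ 7 / 10 ≤ Real.exp x * S x ∧ Real.exp x * S x ≤ 1) ∧ (∀ x, x < 0 → 1 < W x + S x) ∧ (∀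 x, 0 < x → W x + S x < 1) ∧ W 0 + S 0 = 1 ∧ (∀ x y, x ≤ y → y ≤ 1 → S y ≤ S x) := by
  intro r W S hP hT
  obtain ⟨-, -, hWs, hSs, hSpos, -⟩ := hP
  obtain ⟨h0, hsup, hsub, -, -, -, -, hcW, hcS, ⟨W₂, s₀, s₂, hW₂, hs₀, hs₀', hs₂, hd⟩, -⟩ := hT
  have hS1 : Differentiable ℝ S := hSs.differentiable (by simp)
  have hprod : ∀ x, deriv (fun y => Real.exp y * S y) x = Real.exp x * S x + Real.exp x * deriv S x := fun x =>
    ((Real.hasDerivAt_exp x).mul (hS1 x).hasDerivAt).deriv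
  have he2 : ∀ x, Real.exp (2 * x) = Real.exp x ^ 2 := fun x => by rw [← Real.exp_nat_mul]; norm_num
  have he4 : ∀ x, Real.exp (4 * x) = Real.exp x ^ 4 := fun x => by rw [← Real.exp_nat_mul]; norm_num
  refine ⟨s₀, hs₀, hs₀', fun x hx => ?_, fun x hx => ?_, hsup, hsub, h0, ?_⟩
  · obtain ⟨h1, h2, -, h4, h5, -⟩ := hd x hx
    rw [he2, he4] at h1 h2 h4 h5
    have hE : Real.exp x ^ 2 ≤ 1 := by
      have : Real.exp x ≤ 1 := Real.exp_le_one_iff.2 hx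
      calc Real.exp x ^ 2 ≤ 1 ^ 2 := pow_le_pow_left₀ (Real.exp_pos x).le this 2
        _ = 1 := by ring
    have hE4 : Real.exp x ^ 4 ≤ 1 := by
      have : Real.exp x ≤ 1 := Real.exp_le_one_iff.2 hx
      calc Real.exp x ^ 4 ≤ 1 ^ 4 := pow_le_pow_left₀ (Real.exp_pos x).le this 4
        _ = 1 := by ring
    obtain ⟨hW₂l, hW₂u⟩ := abs_le.1 hW₂
    obtain ⟨hs₂l, hs₂u⟩ := abs_le.1 hs₂
    have hA : |W x - (r - 1)| ≤ Real.exp x ^ 2 / 10 + 2 * Real.exp x ^ 4 := by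
      have e1 : W x - (r - 1) = (W x - (r - 1) - W₂ * Real.exp x ^ 2) + W₂ * Real.exp x ^ 2 := by ring
      rw [e1]
      calc _ ≤ |W x - (r - 1) - W₂ * Real.exp x ^ 2| + |W₂ * Real.exp x ^ 2| := abs_add_le _ _
        _ ≤ 2 * Real.exp x ^ 4 + 1 / 10 * Real.exp x ^ 2 := by
          refine add_le_add h1 ?_
          rw [abs_mul, abs_of_nonneg (by positivity : (0:ℝ) ≤ Real.exp x ^ 2)]
          exact mul_le_mul_of_nonneg_right hW₂ (by positivity)
        _ = _ := by ring
    have hB : |deriv W x| ≤ Real.exp x ^ 2 / 5 + 2 * Real.exp x ^ 4 := by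
      have e1 : deriv W x = (deriv W x - 2 * W₂ * Real.exp x ^ 2) + 2 * W₂ * Real.exp x ^ 2 := by ring
      rw [e1]
      calc _ ≤ |deriv W x - 2 * W₂ * Real.exp x ^ 2| + |2 * W₂ * Real.exp x ^ 2| := abs_add_le _ _
        _ ≤ 2 * Real.exp x ^ 4 + 2 * (1 / 10) * Real.exp x ^ 2 := by
          refine add_le_add h2 ?_
          rw [abs_mul, abs_mul, abs_of_pos (by norm_num : (0:ℝ) < 2), abs_of_nonneg (by positivity : (0:ℝ) ≤ Real.exp x ^ 2)]
          exact mul_le_mul_of_nonneg_right (mul_le_mul_of_nonneg_left hW₂ (by norm_num)) (by positivity)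
        _ = _ := by ring
    have hC : |Real.exp x * S x - s₀| ≤ Real.exp x ^ 2 / 10 + 2 * Real.exp x ^ 4 := by
      have e1 : Real.exp x * S x - s₀ = (Real.exp x * S x - s₀ - s₂ * Real.exp x ^ 2) + s₂ * Real.exp x ^ 2 := by ring
      rw [e1]
      calc _ ≤ |Real.exp x * S x - s₀ - s₂ * Real.exp x ^ 2| + |s₂ * Real.exp x ^ 2| := abs_add_le _ _
        _ ≤ 2 * Real.exp x ^ 4 + 1 / 10 * Real.exp x ^ 2 := by
          refine add_le_add h4 ?_
          rw [abs_mul, abs_of_nonneg (by positivity : (0:ℝ) ≤ Real.exp x ^ 2)]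
          exact mul_le_mul_of_nonneg_right hs₂ (by positivity)
        _ = _ := by ring
    have hD : |Real.exp x * (S x + deriv S x)| ≤ Real.exp x ^ 2 / 5 + 2 * Real.exp x ^ 4 := by
      have e1 : Real.exp x * (S x + deriv S x) =
          (deriv (fun y => Real.exp y * S y) x - 2 * s₂ * Real.exp x ^ 2) + 2 * s₂ * Real.exp x ^ 2 := by rw [hprod]; ring
      rw [e1]
      calc _ ≤ |deriv (fun y => Real.exp y * S y) x - 2 * s₂ * Real.exp x ^ 2| + |2 * s₂ * Real.exp x ^ 2| := abs_add_le _ _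
        _ ≤ 2 * Real.exp x ^ 4 + 2 * (1 / 10) * Real.exp x ^ 2 := by
          refine add_le_add h5 ?_
          rw [abs_mul, abs_mul, abs_of_pos (by norm_num : (0:ℝ) < 2), abs_of_nonneg (by positivity : (0:ℝ) ≤ Real.exp x ^ 2)]
          exact mul_le_mul_of_nonneg_right (mul_le_mul_of_nonneg_left hs₂ (by norm_num)) (by positivity)
        _ = _ := by ring
    refine ⟨hA, hB, hC, hD, ?_⟩
    -- `|S + S′| = e^{−x}|eˣ(S + S′)| ≤ e^{−x}(e^{2x}/5 + 2e^{4x}) = eˣ/5 + 2e^{3x} ≤ 11/5`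
    have he : 0 < Real.exp x := Real.exp_pos x
    have he1 : Real.exp x ≤ 1 := Real.exp_le_one_iff.2 hx
    have h6 : |S x + deriv S x| * Real.exp x ≤ (Real.exp x / 5 + 2 * Real.exp x ^ 3) * Real.exp x := by
      have : |S x + deriv S x| * Real.exp x = |Real.exp x * (S x + deriv S x)| := by
        rw [abs_mul, abs_of_pos he]; ring
      rw [this]
      calc _ ≤ Real.exp x ^ 2 / 5 + 2 * Real.exp x ^ 4 := hD
        _ = (Real.exp x / 5 + 2 * Real.exp x ^ 3) * Real.exp x := by ring
    have h7 := le_of_mul_le_mul_right h6 he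
    have h8 : Real.exp x ^ 3 ≤ 1 := by
      calc Real.exp x ^ 3 ≤ 1 ^ 3 := pow_le_pow_left₀ he.le he1 3
        _ = 1 := by ring
    linarith
  · obtain ⟨h1, h2, -⟩ := hcW x hx
    obtain ⟨h3, h4, -, -⟩ := hcS x hx
    exact ⟨h1, h2, h3, h4⟩
  · -- `S` is decreasing on `x ≤ 1`: `eˣS′ = (eˣS)′ − eˣS ≤ 1/4 − 7/10 < 0`
    intro x y hxy hy1
    have hanti : AntitoneOn S (Iic 1) := by
      refine antitoneOn_of_deriv_nonpos (convex_Iic 1) hSs.continuous.continuousOn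
        (fun z _ => (hS1 z).differentiableWithinAt) fun z hz => ?_
      have hz1 : z ≤ 1 := mem_Iic.1 (interior_subset hz)
      obtain ⟨h7, -, h9, -⟩ := hcS z hz1
      rw [hprod z] at h9
      have h10 := (abs_le.1 h9).2
      have he : 0 < Real.exp z := Real.exp_pos z
      have h11 : Real.exp z * deriv S z < 0 := by linarith
      by_contra hcon; push Not at hcon
      have := mul_pos he hcon
      linarith
    exact hanti (mem_Iic.2 (hxy.trans hy1)) (mem_Iic.2 hy1) hxy

end Summit.AtomisticToContinuum.HydrodynamicLimit.Theorems.PackingAnalyticImplosion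

end
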